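import Mathlib
import HarnessLib
import Summits.AtomisticToContinuum.BoseEinsteinCondensation.Theses.BECThomsonPrinciple
import Literature.MathematicalPhysics.QuantumManyBody.PeriodicBoseGas

/-!
# Sketch — crux-ideate stmt-AtomisticToContinuum-9483 (PeriodicToDirichlet), ideator 2, round 1

First lemmas of the idea cards, typed over existing declarations only (not proved).
-/

noncomputable section

namespace Summit.AtomisticToContinuum.BoseEinsteinCondensation.Cruxes.PeriodicToDirichlet.RewardPaysTheWall

open Literature.MathematicalPhysics.QuantumManyBody.BoseGas
open MeasureTheory Filter

/-- The normalised flat (constant) mode `L^{-3/2} 1_{Λ_L}` of the Dirichlet box. -/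
def boxFlatMode (L : ℝ) : Space → ℂ :=
  (box L).indicator fun _ => ((Real.sqrt (L ^ 3))⁻¹ : ℂ)

/-- The rewarded ("pinned") Dirichlet functional `⟨Ψ, H Ψ⟩ + λ (N − ⟨Ψ, n̂_φ Ψ⟩)` with the box flat
mode `φ`, written additively in `ℝ≥0∞` (`occupation ≤ N`). -/
def pinnedEnergy (v : ℝ → ENNReal) (lam : ℝ) {N : ℕ} {L : ℝ} (Ψ : TrialState N L) : ENNReal :=
  energy v Ψ + ENNReal.ofReal lam * ((N : ENNReal) - occupation N (boxFlatMode L) Ψ.ψ)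

/-- Its infimum over Dirichlet trial states. -/
def pinnedGroundStateEnergy (v : ℝ → ENNReal) (lam : ℝ) (N : ℕ) (L : ℝ) : ENNReal :=
  ⨅ Ψ : TrialState N L, pinnedEnergy v lam Ψ

/-- Periodic (torus) constant-mode BEC at ONE density `ρt` with an explicit constant `c`
(the body of `PeriodicBEC`, instantiated). -/
def PeriodicBECAt (v : ℝ → ENNReal) (ρt c : ℝ) : Prop :=
  ∀ᶠ N : ℕ in atTop, ∃ δ : ENNReal, 0 < δ ∧
    ∀ Ψ : PeriodicTrialState N (sideLength ρt N),
      periodicEnergy v Ψ ≤ periodicGroundStateEnergy v N (sideLength ρt N) + δ →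
        ENNReal.ofReal (c * N) ≤ condensateOccupation N (sideLength ρt N) Ψ.ψ

/-- Rewarded (pinned) flat-mode BEC in the DIRICHLET box at density `ρ`, reward `lam`, constant `c'`:
every `δ`-near-minimiser of the rewarded Dirichlet functional has flat-mode occupation `≥ c' N`. -/
def PinnedDirichletBECAt (v : ℝ → ENNReal) (ρ lam c' : ℝ) : Prop :=
  ∀ᶠ N : ℕ in atTop, ∃ δ : ENNReal, 0 < δ ∧
    ∀ Ψ : TrialState N (sideLength ρ N),
      pinnedEnergy v lam Ψ ≤ pinnedGroundStateEnergy v lam N (sideLength ρ N) + δ →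
        ENNReal.ofReal (c' * N) ≤ occupation N (boxFlatMode (sideLength ρ N)) Ψ.ψ

/-- **First lemma (PinnedTransfer).** Torus BEC at density `ρt` with constant `c` forces, for every
large geometric padding parameter `M` and every reward `λ ≥ λ₀(v, ρt, c, M)`, rewarded flat-mode BEC
with constant `c/2` in the Dirichlet box at the slightly lower density `ρt (M/(M+1))³`
(Basti–Cenatiempo–Schlein unfolding `L ↦ L(1+1/M)` + concavity of the rewarded energies in `λ` +
the in-tree thermodynamic limits of `E₀^per/N`, `E₀^D/N`). Informally `λ₀ ≍ C a ρt /(c M) → 0`. -/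
def PinnedTransfer : Prop :=
  ∀ v : ℝ → ENNReal, IsRepulsiveFiniteRange v → (∃ B : ℝ, ∀ r, v r ≤ ENNReal.ofReal B) →
    ∀ ρt c : ℝ, 0 < ρt → 0 < c → PeriodicBECAt v ρt c →
      ∃ M₀ : ℕ, ∀ M : ℕ, M₀ ≤ M → ∃ lam₀ : ℝ, 0 < lam₀ ∧ ∀ lam : ℝ, lam₀ ≤ lam →
        PinnedDirichletBECAt v (ρt * ((M : ℝ) / (M + 1)) ^ 3) lam (c / 2)

/-- **Residual crux of the line (UnpinningWindow), typed as the implication it must deliver.**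
For each density there is a window top `λ₁ > 0` (from the conditional spectral constants of the
rewarded Dirichlet gas) such that rewarded flat-mode BEC at ANY single reward `λ ∈ (0, λ₁]`
(constant `c'`) already forces flat-mode BEC of the un-rewarded Dirichlet near-minimisers with
constant `c'/2` — the GMOR susceptibility walk `n(0) ≥ n(λ) − ∫₀^{λ} χ` run down from the anchor.
`PinnedTransfer` supplies the anchor at `λ = λ₁` (choose `M` with `λ₀(M) ≤ λ₁`). -/
def UnpinningWindow : Prop :=
  ∀ v : ℝ → ENNReal, IsRepulsiveFiniteRange v → (∃ B : ℝ, ∀ r, v r ≤ ENNReal.ofReal B) →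
    ∀ c' : ℝ, 0 < c' → ∃ ρ₀ : ℝ, 0 < ρ₀ ∧ ∀ ρ : ℝ, 0 < ρ → ρ < ρ₀ → ∃ lam₁ : ℝ, 0 < lam₁ ∧
      ∀ lam : ℝ, 0 < lam → lam ≤ lam₁ →
        PinnedDirichletBECAt v ρ lam c' → PinnedDirichletBECAt v ρ 0 (c' / 2)

/-- Sanity: at reward `0` the rewarded functional is the energy, so `PinnedDirichletBECAt v ρ 0 c'`
is literally flat-mode BEC of the Dirichlet near-minimisers (the input of the in-tree
`bec_of_zeroMode`-type glue). -/
theorem pinnedEnergy_zero (v : ℝ → ENNReal) {N : ℕ} {L : ℝ} (Ψ : TrialState N L) :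
    pinnedEnergy v 0 Ψ = energy v Ψ := by
  simp [pinnedEnergy]

end Summit.AtomisticToContinuum.BoseEinsteinCondensation.Cruxes.PeriodicToDirichlet.RewardPaysTheWall

end
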